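import Summits.AtomisticToContinuum.Crystallization.Theorems.PalmUnimodularRigidityUnimodularEnergyLowerBound
import Literature.Probability.Process.PointStationaryTransfer
import HarnessLib

/-!
# Palm copositivity: the weighted ball transport of `e_uni ≥ e*`

Stub `stub_palmCopositivity` of line `perron_transfer` of the crux
`IsometryAtoms.MinimisingLawsHaveAtoms` (stmt-AtomisticToContinuum-15776), step 2b of the BRIDGE
"K* ⇒ minimising point-stationary laws are a.s. sitewise `2e*`-bound".

**Statement.**  Assume the WEIGHTED CLUSTER INEQUALITY (the output of step 2a, fed by the copositive
floor K*): for every `δ`-separated `S ⊂ ℝ³`, all weights `c ≤ 1` on `ℝ³`, every ball `B = B(v,R)` and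
`μ = count|S`,
`∫_B c(y) ∫ c(z) V⁻(‖z-y‖) dμ dμ(y) ≤ ∫_B [c(y) ∫ c(z) V⁺(‖z-y‖) dμ + 2(-e*) c(y)² + c(y) ∫_{Bᶜ} c(z) V⁻(‖z-y‖) dμ] dμ(y)`.
Then for every point-stationary probability law `P` carried by rooted `δ`-hard-core configurations and
every measurable weight `w ≤ 1` on configurations,
`E_P[w(μ) Σ_z w(θ_z μ) V⁻(‖z‖)] ≤ E_P[w(μ) Σ_z w(θ_z μ) V⁺(‖z‖)] + 2(-e*) E_P[w(μ)²]`,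
`θ_z μ = μ.map (· - z)` the configuration re-rooted at its point `z`.

**Proof.**  The proof of the landed theorem 9229 `UnimodularEnergy.eStar_le_integral_rootEnergy`
(`e* ≤ E_P[h]`, the case `w = 1`) with the payloads multiplied by the weights `w(μ) · w(θ_z μ)`:
the mass transport through ball centres (`UnimodularEnergy.lintegral_mass_transport_ball`) applied to
`F_B(μ,v) = w(μ) Σ_z w(θ_z μ) V⁻(‖z‖)` and to
`F_A(μ,v) = w(μ) Σ_z w(θ_z μ) V⁺(‖z‖) + 2(-e*) w(μ)² + w(μ) Σ_{z ∉ B(v,R)} w(θ_z μ) V⁻(‖z‖)`; on the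
received sides both payloads are summed over the points `y` of a common ball `S ∩ B(v,R)` of the
configuration re-rooted at `y`, where `θ_z (θ_y μ) = θ_{z+y} μ`, so that they are the two sides of the
weighted cluster inequality with the weights `c(x) = w(θ_x μ) ≤ 1`; the error term is at most the
unweighted one of 9229 (`w ≤ 1`), which tends to `0` along `R = n + 1`
(`UnimodularEnergy.error_term_eq`, `UnimodularEnergy.tendsto_lintegral_lintegral_neg_lennardJones_mul`).
Joint measurability in `(μ, v)` goes through the truncated identity kernel `κ`
(`UnimodularEnergy.exists_kernel_eq_self`) and `Literature.Probability.Process.measurable_map_sub_kernel`.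
All `[folklore]` (Mecke / mass-transport bookkeeping).
-/

noncomputable section

namespace Summit.AtomisticToContinuum.Crystallization.Theorems.IsometryAtomsMinimisingLawsHaveAtoms

open MeasureTheory Metric Set Filter ProbabilityTheory
open scoped ENNReal Topology
open Literature.MathematicalPhysics.StatisticalMechanics Literature.Probability.Process
open Summit.AtomisticToContinuum.Crystallization.Theorems.ChargedEnergyGapNegative (E3)
open Summit.AtomisticToContinuum.Crystallization.Theorems.UnimodularEnergy

/-! ### Two bookkeeping lemmas -/

/-- For an s-finite kernel `κ` and a jointly measurable `f ≥ 0`,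
`(a, v) ↦ ∫⁻ z in (ball v R)ᶜ, f (a, z) ∂(κ a)` is jointly measurable. [folklore] -/
private theorem pcop_measurable_setLIntegral_compl_ball {α : Type*} [MeasurableSpace α]
    (κ : Kernel α E3) [IsSFiniteKernel κ] {f : α × E3 → ℝ≥0∞} (hf : Measurable f) (R : ℝ) :
    Measurable fun p : α × E3 => ∫⁻ z in (ball p.2 R)ᶜ, f (p.1, z) ∂(κ p.1) := by
  have hset : MeasurableSet {q : (α × E3) × E3 | q.2 ∉ ball q.1.2 R} :=
    (measurableSet_lt (measurable_snd.dist measurable_fst.snd) measurable_const).compl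
  have hg : Measurable fun q : (α × E3) × E3 =>
      {q : (α × E3) × E3 | q.2 ∉ ball q.1.2 R}.indicator (fun q => f (q.1.1, q.2)) q :=
    (hf.comp (measurable_fst.fst.prodMk measurable_snd)).indicator hset
  have h := hg.lintegral_kernel_prod_right' (κ := Kernel.prodMkRight E3 κ)
  have heq : (fun p : α × E3 => ∫⁻ z in (ball p.2 R)ᶜ, f (p.1, z) ∂(κ p.1)) = fun p =>
      ∫⁻ z, {q : (α × E3) × E3 | q.2 ∉ ball q.1.2 R}.indicator (fun q => f (q.1.1, q.2)) (p, z)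
        ∂(Kernel.prodMkRight E3 κ p) := by
    funext p
    rw [Kernel.prodMkRight_apply, ← lintegral_indicator measurableSet_ball.compl]
    refine lintegral_congr fun z => ?_
    by_cases hz : z ∈ ball p.2 R
    · have h1 : z ∉ (ball p.2 R)ᶜ := fun h' => h' hz
      have h2 : (p, z) ∉ {q : (α × E3) × E3 | q.2 ∉ ball q.1.2 R} := fun h' => h' hz
      rw [Set.indicator_of_notMem h1, Set.indicator_of_notMem h2]
    · have h1 : z ∈ (ball p.2 R)ᶜ := hz
      have h2 : (p, z) ∈ {q : (α × E3) × E3 | q.2 ∉ ball q.1.2 R} := hz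
      rw [Set.indicator_of_mem h1, Set.indicator_of_mem h2]
  rw [heq]
  exact h

/-- Re-rooting twice: `θ_{z-y} (θ_y μ) = θ_z μ`. [folklore] -/
private theorem pcop_map_sub_map_sub (μ : Measure E3) (y z : E3) :
    (μ.map fun x => x - y).map (fun x => x - (z - y)) = μ.map fun x => x - z := by
  rw [Measure.map_map (measurable_sub_const (z - y)) (measurable_sub_const y)]
  congr 1
  funext x
  show x - y - (z - y) = x - z
  exact sub_sub_sub_cancel_right x z y

/-! ### Step 1: one radius -/

section Main

variable {δ : ℝ} {P : Measure (Measure E3)}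

/-- **One radius.**  Under the weighted cluster inequality, for a point-stationary law carried by
rooted `δ`-hard-core configurations, an s-finite kernel `κ` equal to the identity there, a measurable
weight `w ≤ 1` and `R > 0`:
`E[w Σ_z w(θ_z ·) V⁻] ≤ E[w Σ_z w(θ_z ·) V⁺ + 2(-e*) w²] + vol(B_R)⁻¹ · E ∫_{B(0,R)} Σ_{z ∉ B(v,R)} V⁻(‖z‖) dv`
(the two weighted mass transports and the weighted cluster inequality). [folklore] -/
private theorem pcop_step
    (hWCI : ∀ δ : ℝ, 0 < δ → ∀ S : Set (EuclideanSpace ℝ (Fin 3)),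
      (∀ x ∈ S, ∀ y ∈ S, x ≠ y → δ ≤ dist x y) → ∀ c : EuclideanSpace ℝ (Fin 3) → ENNReal,
      (∀ x, c x ≤ 1) → ∀ (v : EuclideanSpace ℝ (Fin 3)) (R : ℝ),
      ∫⁻ y in Metric.ball v R, c y * (∫⁻ z, c z * ENNReal.ofReal (-lennardJones ‖z - y‖)
        ∂((Measure.count : Measure (EuclideanSpace ℝ (Fin 3))).restrict S))
        ∂((Measure.count : Measure (EuclideanSpace ℝ (Fin 3))).restrict S) ≤
      ∫⁻ y in Metric.ball v R, (c y * (∫⁻ z, c z * ENNReal.ofReal (lennardJones ‖z - y‖)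
        ∂((Measure.count : Measure (EuclideanSpace ℝ (Fin 3))).restrict S)) +
        2 * ENNReal.ofReal (-(⨅ Q : PeriodicConfiguration 3, Q.energyPerParticle lennardJones)) *
          (c y) ^ 2 +
        c y * (∫⁻ z in (Metric.ball v R)ᶜ, c z * ENNReal.ofReal (-lennardJones ‖z - y‖)
          ∂((Measure.count : Measure (EuclideanSpace ℝ (Fin 3))).restrict S)))
        ∂((Measure.count : Measure (EuclideanSpace ℝ (Fin 3))).restrict S))
    (hδ : 0 < δ) (κ : Kernel (Measure E3) E3) [IsSFiniteKernel κ]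
    (hκ : ∀ μ : Measure E3, IsRootedHardCore δ μ → κ μ = μ)
    (hcore : ∀ᵐ μ ∂P, IsRootedHardCore δ μ) (hstat : IsPointStationaryLaw P)
    {w : Measure E3 → ℝ≥0∞} (hw : Measurable w) (hw1 : ∀ μ, w μ ≤ 1) {R : ℝ} (hR : 0 < R) :
    ∫⁻ μ, w μ * (∫⁻ z, w ((κ μ).map fun x => x - z) * ENNReal.ofReal (-lennardJones ‖z‖) ∂(κ μ)) ∂P ≤
      ∫⁻ μ, (w μ * (∫⁻ z, w ((κ μ).map fun x => x - z) * ENNReal.ofReal (lennardJones ‖z‖) ∂(κ μ)) +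
          2 * ENNReal.ofReal (-(⨅ Q : PeriodicConfiguration 3, Q.energyPerParticle lennardJones)) *
            (w μ) ^ 2) ∂P +
        (∫⁻ μ, (∫⁻ v in ball (0 : E3) R, ∫⁻ z in (ball v R)ᶜ, ENNReal.ofReal (-lennardJones ‖z‖)
          ∂(κ μ)) ∂P) / volume (ball (0 : E3) R) := by
  set m : E3 → ℝ≥0∞ := fun z => ENNReal.ofReal (-lennardJones ‖z‖) with hm_def
  set p : E3 → ℝ≥0∞ := fun z => ENNReal.ofReal (lennardJones ‖z‖) with hp_def
  have hm : Measurable m := measurable_ofReal_neg_lennardJones_norm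
  have hp : Measurable p := measurable_ofReal_lennardJones_norm
  set c : ℝ≥0∞ := 2 * ENNReal.ofReal
    (-(⨅ Q : PeriodicConfiguration 3, Q.energyPerParticle lennardJones)) with hc_def
  set V : ℝ≥0∞ := volume (ball (0 : E3) R) with hV_def
  have hV0 : V ≠ 0 := (measure_ball_pos volume (0 : E3) hR).ne'
  have hVtop : V ≠ ∞ := measure_ball_lt_top.ne
  -- the weight of the re-rooted configuration, through the kernel
  set W : Measure E3 × E3 → ℝ≥0∞ := fun q => w ((κ q.1).map fun x => x - q.2) with hW_def
  have hW : Measurable W := hw.comp (measurable_map_sub_kernel κ)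
  have hW1 : ∀ q, W q ≤ 1 := fun q => hw1 _
  have hIm : Measurable fun ν : Measure E3 => ∫⁻ z, W (ν, z) * m z ∂(κ ν) :=
    (hW.mul (hm.comp measurable_snd)).lintegral_kernel_prod_right'
  have hIp : Measurable fun ν : Measure E3 => ∫⁻ z, W (ν, z) * p z ∂(κ ν) :=
    (hW.mul (hp.comp measurable_snd)).lintegral_kernel_prod_right'
  have hTail : Measurable fun q : Measure E3 × E3 =>
      ∫⁻ z in (ball q.2 R)ᶜ, W (q.1, z) * m z ∂(κ q.1) :=
    pcop_measurable_setLIntegral_compl_ball κ (hW.mul (hm.comp measurable_snd)) R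
  show ∫⁻ μ, w μ * (∫⁻ z, W (μ, z) * m z ∂(κ μ)) ∂P ≤
      ∫⁻ μ, (w μ * (∫⁻ z, W (μ, z) * p z ∂(κ μ)) + c * (w μ) ^ 2) ∂P +
        (∫⁻ μ, (∫⁻ v in ball (0 : E3) R, ∫⁻ z in (ball v R)ᶜ, m z ∂(κ μ)) ∂P) / V
  -- the two payloads
  set FA : Measure E3 → E3 → ℝ≥0∞ := fun ν v =>
    w ν * (∫⁻ z, W (ν, z) * p z ∂(κ ν)) + c * (w ν) ^ 2 +
      w ν * ∫⁻ z in (ball v R)ᶜ, W (ν, z) * m z ∂(κ ν) with hFA_def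
  set FB : Measure E3 → E3 → ℝ≥0∞ := fun ν _ => w ν * ∫⁻ z, W (ν, z) * m z ∂(κ ν) with hFB_def
  have hFA : Measurable (Function.uncurry FA) := by
    show Measurable fun q : Measure E3 × E3 =>
      w q.1 * (∫⁻ z, W (q.1, z) * p z ∂(κ q.1)) + c * (w q.1) ^ 2 +
        w q.1 * ∫⁻ z in (ball q.2 R)ᶜ, W (q.1, z) * m z ∂(κ q.1)
    exact (((hw.comp measurable_fst).mul (hIp.comp measurable_fst)).add
      (((hw.comp measurable_fst).pow_const 2).const_mul c)).add
        ((hw.comp measurable_fst).mul hTail)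
  have hFB : Measurable (Function.uncurry FB) := by
    show Measurable fun q : Measure E3 × E3 => w q.1 * ∫⁻ z, W (q.1, z) * m z ∂(κ q.1)
    exact (hw.comp measurable_fst).mul (hIm.comp measurable_fst)
  have hA := lintegral_mass_transport_ball hδ κ hκ hcore hstat R hFA
  have hB := lintegral_mass_transport_ball hδ κ hκ hcore hstat R hFB
  -- received sides: the weighted cluster inequality
  have hrecv : ∫⁻ μ, (∫⁻ v in ball (0 : E3) R,
      (∫⁻ y in ball v R, FB (μ.map fun z => z - y) (v - y) ∂μ) / μ (ball v R)) ∂P ≤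
      ∫⁻ μ, (∫⁻ v in ball (0 : E3) R,
        (∫⁻ y in ball v R, FA (μ.map fun z => z - y) (v - y) ∂μ) / μ (ball v R)) ∂P := by
    refine lintegral_mono_ae (hcore.mono fun μ hμ => ?_)
    refine lintegral_mono fun v => ENNReal.div_le_div_right ?_ _
    have hμ' := hμ
    obtain ⟨S, -, hsep, rfl⟩ := hμ
    have hS := countable_of_separated hδ hsep
    have hae := ae_restrict_of_ae (s := ball v R) (ae_mem_count_restrict hS)
    -- the weights of the configuration re-rooted at its points
    set cS : E3 → ℝ≥0∞ := fun x =>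
      w (((Measure.count : Measure E3).restrict S).map fun x' => x' - x) with hcS_def
    have hcS1 : ∀ x, cS x ≤ 1 := fun x => hw1 _
    have hθ : ∀ y ∈ S, κ (((Measure.count : Measure E3).restrict S).map fun x => x - y) =
        ((Measure.count : Measure E3).restrict S).map fun x => x - y := fun y hy =>
      hκ _ (hμ'.map_sub ((count_restrict_singleton_ne_zero_iff S y).2 hy))
    have hWθ : ∀ y ∈ S, ∀ z : E3,
        W ((((Measure.count : Measure E3).restrict S).map fun x => x - y), z - y) = cS z := by
      intro y hy z
      show w ((κ (((Measure.count : Measure E3).restrict S).map fun x => x - y)).map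
        fun x => x - (z - y)) = w (((Measure.count : Measure E3).restrict S).map fun x' => x' - z)
      rw [hθ y hy, pcop_map_sub_map_sub]
    have hWm : ∀ y : E3, Measurable fun z : E3 =>
        W ((((Measure.count : Measure E3).restrict S).map fun x => x - y), z) * m z := fun y =>
      (hW.comp measurable_prodMk_left).mul hm
    have hWp : ∀ y : E3, Measurable fun z : E3 =>
        W ((((Measure.count : Measure E3).restrict S).map fun x => x - y), z) * p z := fun y =>
      (hW.comp measurable_prodMk_left).mul hp
    have haeB : ∀ᵐ y ∂(((Measure.count : Measure E3).restrict S).restrict (ball v R)),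
        FB (((Measure.count : Measure E3).restrict S).map fun z => z - y) (v - y) =
          cS y * (∫⁻ z, cS z * ENNReal.ofReal (-lennardJones ‖z - y‖)
            ∂((Measure.count : Measure E3).restrict S)) := by
      refine hae.mono fun y hy => ?_
      simp only [hFB_def]
      rw [hθ y hy, lintegral_map_sub _ _ (hWm y)]
      simp only [hWθ y hy]
      rfl
    have haeA : ∀ᵐ y ∂(((Measure.count : Measure E3).restrict S).restrict (ball v R)),
        FA (((Measure.count : Measure E3).restrict S).map fun z => z - y) (v - y) =
          cS y * (∫⁻ z, cS z * ENNReal.ofReal (lennardJones ‖z - y‖)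
            ∂((Measure.count : Measure E3).restrict S)) + c * (cS y) ^ 2 +
          cS y * (∫⁻ z in (ball v R)ᶜ, cS z * ENNReal.ofReal (-lennardJones ‖z - y‖)
            ∂((Measure.count : Measure E3).restrict S)) := by
      refine hae.mono fun y hy => ?_
      simp only [hFA_def]
      rw [hθ y hy, lintegral_map_sub _ _ (hWp y),
        setLIntegral_compl_ball_map_sub _ _ _ _ (hWm y), sub_add_cancel]
      simp only [hWθ y hy]
      rfl
    rw [lintegral_congr_ae haeB, lintegral_congr_ae haeA]
    exact hWCI δ hδ S hsep cS hcS1 v R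
  -- sent sides
  have hsentB : ∫⁻ μ, (∫⁻ v in ball (0 : E3) R, FB μ v) ∂P =
      (∫⁻ μ, w μ * (∫⁻ z, W (μ, z) * m z ∂(κ μ)) ∂P) * V := by
    have hH : Measurable fun ν : Measure E3 => w ν * ∫⁻ z, W (ν, z) * m z ∂(κ ν) := hw.mul hIm
    simp only [hFB_def, setLIntegral_const]
    rw [lintegral_mul_const _ hH]
  have hG : Measurable fun μ : Measure E3 =>
      w μ * (∫⁻ z, W (μ, z) * p z ∂(κ μ)) + c * (w μ) ^ 2 :=
    (hw.mul hIp).add ((hw.pow_const 2).const_mul c)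
  have hsentA : ∫⁻ μ, (∫⁻ v in ball (0 : E3) R, FA μ v) ∂P =
      (∫⁻ μ, (w μ * (∫⁻ z, W (μ, z) * p z ∂(κ μ)) + c * (w μ) ^ 2) ∂P) * V +
        ∫⁻ μ, (∫⁻ v in ball (0 : E3) R,
          w μ * ∫⁻ z in (ball v R)ᶜ, W (μ, z) * m z ∂(κ μ)) ∂P := by
    have h1 : ∀ μ : Measure E3, ∫⁻ v in ball (0 : E3) R, FA μ v =
        (w μ * (∫⁻ z, W (μ, z) * p z ∂(κ μ)) + c * (w μ) ^ 2) * V +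
          ∫⁻ v in ball (0 : E3) R, w μ * ∫⁻ z in (ball v R)ᶜ, W (μ, z) * m z ∂(κ μ) := by
      intro μ
      simp only [hFA_def]
      rw [lintegral_add_left measurable_const, setLIntegral_const]
    simp_rw [h1]
    rw [lintegral_add_left (hG.mul_const _), lintegral_mul_const _ hG]
  -- the weighted error term is at most the unweighted one
  have herr : ∫⁻ μ, (∫⁻ v in ball (0 : E3) R,
      w μ * ∫⁻ z in (ball v R)ᶜ, W (μ, z) * m z ∂(κ μ)) ∂P ≤
      ∫⁻ μ, (∫⁻ v in ball (0 : E3) R, ∫⁻ z in (ball v R)ᶜ, m z ∂(κ μ)) ∂P := by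
    refine lintegral_mono fun μ => lintegral_mono fun v => ?_
    calc w μ * ∫⁻ z in (ball v R)ᶜ, W (μ, z) * m z ∂(κ μ)
        ≤ 1 * ∫⁻ z in (ball v R)ᶜ, m z ∂(κ μ) :=
          mul_le_mul' (hw1 μ) (lintegral_mono fun z => by
            calc W (μ, z) * m z ≤ 1 * m z := mul_le_mul' (hW1 _) le_rfl
              _ = m z := one_mul _)
      _ = ∫⁻ z in (ball v R)ᶜ, m z ∂(κ μ) := one_mul _
  -- combine: sent_B = received_B ≤ received_A = sent_A
  have hineq : (∫⁻ μ, w μ * (∫⁻ z, W (μ, z) * m z ∂(κ μ)) ∂P) * V ≤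
      (∫⁻ μ, (w μ * (∫⁻ z, W (μ, z) * p z ∂(κ μ)) + c * (w μ) ^ 2) ∂P) * V +
        ∫⁻ μ, (∫⁻ v in ball (0 : E3) R, ∫⁻ z in (ball v R)ᶜ, m z ∂(κ μ)) ∂P := by
    rw [← hsentB, hB]
    refine hrecv.trans ?_
    rw [← hA, hsentA]
    exact add_le_add le_rfl herr
  -- divide by the volume
  calc ∫⁻ μ, w μ * (∫⁻ z, W (μ, z) * m z ∂(κ μ)) ∂P
      = (∫⁻ μ, w μ * (∫⁻ z, W (μ, z) * m z ∂(κ μ)) ∂P) * V / V :=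
        (ENNReal.mul_div_cancel_right hV0 hVtop).symm
    _ ≤ ((∫⁻ μ, (w μ * (∫⁻ z, W (μ, z) * p z ∂(κ μ)) + c * (w μ) ^ 2) ∂P) * V +
          ∫⁻ μ, (∫⁻ v in ball (0 : E3) R, ∫⁻ z in (ball v R)ᶜ, m z ∂(κ μ)) ∂P) / V :=
        ENNReal.div_le_div_right hineq _
    _ = ∫⁻ μ, (w μ * (∫⁻ z, W (μ, z) * p z ∂(κ μ)) + c * (w μ) ^ 2) ∂P +
          (∫⁻ μ, (∫⁻ v in ball (0 : E3) R, ∫⁻ z in (ball v R)ᶜ, m z ∂(κ μ)) ∂P) / V := by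
        rw [ENNReal.add_div, ENNReal.mul_div_cancel_right hV0 hVtop]

end Main

/-! ### The limit `R = n + 1 → ∞` and the registered statement -/

/-- **Palm copositivity** (stub `stub_palmCopositivity` of line `perron_transfer`).  Under the
weighted cluster inequality, for every `δ > 0`, every point-stationary probability law `P` carried by
rooted `δ`-hard-core configurations of `ℝ³` and every measurable weight `w ≤ 1` on configurations,
`E_P[w(μ) Σ_z w(θ_z μ) V⁻(‖z‖)] ≤ E_P[w(μ) Σ_z w(θ_z μ) V⁺(‖z‖)] + 2(-e*) E_P[w(μ)²]`
(the ball-centre mass transport of 9229 with weights, then `R → ∞`). [folklore] -/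
theorem stub_palmCopositivity :
    (∀ δ : ℝ, 0 < δ → ∀ S : Set (EuclideanSpace ℝ (Fin 3)), (∀ x ∈ S, ∀ y ∈ S, x ≠ y → δ ≤ dist x y) → ∀ c : EuclideanSpace ℝ (Fin 3) → ENNReal, (∀ x, c x ≤ 1) → ∀ (v : EuclideanSpace ℝ (Fin 3)) (R : ℝ), ∫⁻ y in Metric.ball v R, c y * (∫⁻ z, c z * ENNReal.ofReal (-Literature.MathematicalPhysics.StatisticalMechanics.lennardJones ‖z - y‖) ∂((MeasureTheory.Measure.count : MeasureTheory.Measure (EuclideanSpace ℝ (Fin 3))).restrict S)) ∂((MeasureTheory.Measure.count : MeasureTheory.Measure (EuclideanSpace ℝ (Fin 3))).restrict S) ≤ ∫⁻ y in Metric.ball v R, (c y * (∫⁻ z, c z * ENNReal.ofReal (Literature.MathematicalPhysics.StatisticalMechanics.lennardJones ‖z - y‖) ∂((MeasureTheory.Measure.count : MeasureTheory.Measure (EuclideanSpace ℝ (Fin 3))).restrict S)) + 2 * ENNReal.ofReal (-(⨅ Q : Literature.MathematicalPhysics.StatisticalMechanics.PeriodicConfiguration 3, Q.energyPerParticle Literature.MathematicalPhysics.StatisticalMechanics.lennardJones))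 * (c y) ^ 2 + c y * (∫⁻ z in (Metric.ball v R)ᶜ, c z * ENNReal.ofReal (-Literature.MathematicalPhysics.StatisticalMechanics.lennardJones ‖z - y‖) ∂((MeasureTheory.Measure.count : MeasureTheory.Measure (EuclideanSpace ℝ (Fin 3))).restrict S))) ∂((MeasureTheory.Measure.count : MeasureTheory.Measure (EuclideanSpace ℝ (Fin 3))).restrict S)) → ∀ δ : ℝ, 0 < δ → ∀ P : MeasureTheory.Measure (MeasureTheory.Measure (EuclideanSpace ℝ (Fin 3))), MeasureTheory.IsProbabilityMeasure P → (∀ᵐ μ ∂P, Literature.Probability.Process.IsRootedHardCore δ μ) → Literature.Probability.Process.IsPointStationaryLaw P → ∀ w : MeasureTheory.Measure (EuclideanSpace ℝ (Fin 3)) → ENNReal, Measurable w → (∀ μ, w μ ≤ 1) → ∫⁻ μ, w μ * (∫⁻ z, w (MeasureTheory.Measure.map (fun x => x - z) μ) * ENNReal.ofReal (-Literature.MathematicalPhysics.StatisticalMechanics.lennardJones ‖z‖) ∂μ) ∂P ≤ ∫⁻ μ, w μ * (∫⁻ z, w (MeasureTheory.Measure.map (fun x => x - z) μ) * ENNReal.ofReal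 (Literature.MathematicalPhysics.StatisticalMechanics.lennardJones ‖z‖) ∂μ) ∂P + 2 * ENNReal.ofReal (-(⨅ Q : Literature.MathematicalPhysics.StatisticalMechanics.PeriodicConfiguration 3, Q.energyPerParticle Literature.MathematicalPhysics.StatisticalMechanics.lennardJones)) * ∫⁻ μ, (w μ) ^ 2 ∂P := by
  intro hWCI δ hδ P hP hcore hstat w hw hw1
  obtain ⟨κ, hκs, hκ⟩ := exists_kernel_eq_self hδ
  set m : E3 → ℝ≥0∞ := fun z => ENNReal.ofReal (-lennardJones ‖z‖) with hm_def
  set p : E3 → ℝ≥0∞ := fun z => ENNReal.ofReal (lennardJones ‖z‖) with hp_def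
  have hp : Measurable p := measurable_ofReal_lennardJones_norm
  set c : ℝ≥0∞ := 2 * ENNReal.ofReal
    (-(⨅ Q : PeriodicConfiguration 3, Q.energyPerParticle lennardJones)) with hc_def
  set W : Measure E3 × E3 → ℝ≥0∞ := fun q => w ((κ q.1).map fun x => x - q.2) with hW_def
  have hW : Measurable W := hw.comp (measurable_map_sub_kernel κ)
  -- the two weighted functionals, through the kernel
  set Hm : Measure E3 → ℝ≥0∞ := fun ν => w ν * ∫⁻ z, W (ν, z) * m z ∂(κ ν) with hHm_def
  set Hp : Measure E3 → ℝ≥0∞ := fun ν =>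
    w ν * (∫⁻ z, W (ν, z) * p z ∂(κ ν)) + c * (w ν) ^ 2 with hHp_def
  -- Step 1 along `R = n + 1`, and the limit
  set T : ℕ → ℝ≥0∞ := fun n => ∫⁻ μ, (∫⁻ z, m z *
      (volume (ball (0 : E3) ((n : ℝ) + 1) \ ball z ((n : ℝ) + 1)) /
        volume (ball (0 : E3) ((n : ℝ) + 1))) ∂(κ μ)) ∂P with hT_def
  have hstep : ∀ n : ℕ, ∫⁻ μ, Hm μ ∂P ≤ ∫⁻ μ, Hp μ ∂P + T n := by
    intro n
    have h := pcop_step hWCI hδ κ hκ hcore hstat hw hw1 (R := (n : ℝ) + 1) (by positivity)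
    rwa [error_term_eq hδ κ hκ hcore n] at h
  have hT : Tendsto T atTop (𝓝 0) :=
    tendsto_lintegral_lintegral_neg_lennardJones_mul hδ κ hκ hcore
  have hlim : ∫⁻ μ, Hm μ ∂P ≤ ∫⁻ μ, Hp μ ∂P := by
    have h2 : Tendsto (fun n => ∫⁻ μ, Hp μ ∂P + T n) atTop (𝓝 (∫⁻ μ, Hp μ ∂P + 0)) :=
      tendsto_const_nhds.add hT
    rw [add_zero] at h2
    exact ge_of_tendsto' h2 hstep
  -- back to the configuration itself: `κ μ = μ` almost surely
  have haem : ∀ᵐ μ ∂P, Hm μ = w μ * ∫⁻ z, w (μ.map fun x => x - z) * m z ∂μ :=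
    hcore.mono fun μ hμ => by simp only [hHm_def, hW_def, hκ μ hμ]
  have haep : ∀ᵐ μ ∂P, w μ * (∫⁻ z, W (μ, z) * p z ∂(κ μ)) =
      w μ * ∫⁻ z, w (μ.map fun x => x - z) * p z ∂μ :=
    hcore.mono fun μ hμ => by simp only [hW_def, hκ μ hμ]
  have hmeas : Measurable fun μ : Measure E3 => w μ * ∫⁻ z, W (μ, z) * p z ∂(κ μ) :=
    hw.mul (hW.mul (hp.comp measurable_snd)).lintegral_kernel_prod_right'
  calc ∫⁻ μ, w μ * (∫⁻ z, w (μ.map fun x => x - z) * m z ∂μ) ∂P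
      = ∫⁻ μ, Hm μ ∂P := (lintegral_congr_ae haem).symm
    _ ≤ ∫⁻ μ, Hp μ ∂P := hlim
    _ = ∫⁻ μ, (w μ * (∫⁻ z, W (μ, z) * p z ∂(κ μ)) + c * (w μ) ^ 2) ∂P := rfl
    _ = ∫⁻ μ, w μ * (∫⁻ z, W (μ, z) * p z ∂(κ μ)) ∂P + c * ∫⁻ μ, (w μ) ^ 2 ∂P := by
        rw [lintegral_add_left hmeas, lintegral_const_mul _ (hw.pow_const 2)]
    _ = ∫⁻ μ, w μ * (∫⁻ z, w (μ.map fun x => x - z) * p z ∂μ) ∂P + c * ∫⁻ μ, (w μ) ^ 2 ∂P := by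
        rw [lintegral_congr_ae haep]

end Summit.AtomisticToContinuum.Crystallization.Theorems.IsometryAtomsMinimisingLawsHaveAtoms

end
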